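import Mathlib
import HarnessLib

/-!
# Hintz 2026 vs Klainerman–Szeftel: the two initial-data DECAY CLASSES are incomparable
# (radial model classes; kernel record of a prose comparison)

P. Hintz, *Nonlinear stability of subextremal Kerr black holes*, arXiv:2606.28253 **v2** (2026-08-03) —
an UNREFEREED CLAIM under adjudication in this library (`KerrStabilitySubextremalCauchy.lean` carries
its main theorem as `@[claim "Hintz2026" "under-review"]`; nothing in the present file asserts or uses
any stability statement) — admits, in Thm 1.1 / (1.4)–(1.5) (p. 2–3) and Thm 13.1 (13.1a) (p. 318),
initial data whose deviation from Kerr data is **partially polyhomogeneous**: a FINITE expansion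
`Σ_{(z,k) ∈ 𝓔₀} r^{-z} (log r)^k γ^{(z,k)}(ω)` with `min Re 𝓔₀ > 1 + ε₀` plus a remainder of
conormal decay `O(r^{-3-ε₀})`. The Klainerman–Szeftel theorem (`StabilityCauchy.lean`,
`klainerman_szeftel_kerr_stability_small_a_cauchy`) takes "structureless" data with
`O(r^{-3/2-δ})`-type decay of `(γ, r k)` towards Kerr data. Two prose comparisons of these classes are
in print: Hintz v2, footnote 1 (TeX l.1045, p. 2–3: Thm 13.1 "does not imply the main results of
[Klainerman–Szeftel] … which apply to data having 'structureless' `O(r^{-3/2-ε₀})`-decay …; for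
structureless data, our result requires `O(r^{-3-ε₀})`-decay. Conversely, these results do not imply
Theorem 13.1 … as we can handle more weakly decaying (`O(r^{-1-ε₀})`), albeit structured, initial
data" — a footnote ABSENT from v1), and He–Klainerman, arXiv:2607.08958 (2026), p. 6: "only the
`O(r^{-3-ε})` component is generic; in this sense the result is more restrictive than the
`O(r^{-3/2-ε})` assumptions used in [KS, GKS, MS]".

This file records the comparison at the level of **radial model classes** of real functions of
`r → ∞` (size only; no angular dependence, no derivatives, no constraint equations — deliberately the
crudest model in which the two prose statements are already decidable):

* `Hintz2026.PhgClass E ε₀ f` : `f − Σ_{(z,k) ∈ E} c_{(z,k)} r^{-z} (log r)^k = O(r^{-(3+ε₀)})`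
  for some coefficients `c`, `E` a finite set of (real exponent, natural log-power) pairs;
* `Hintz2026.StructurelessClass δ f` : `f = O(r^{-(3/2+δ)})`.

Results (all elementary real analysis, `r → ∞` along `Filter.atTop`):

1. `rpow_mem_phgClass`, `rpow_not_structurelessClass`: `r ↦ r^{-5/4}` is in `PhgClass {(5/4,0)} ε₀`
   for every `ε₀` and in NO `StructurelessClass δ`, `δ > 0` — the structured part of Hintz's class
   is not Klainerman–Szeftel-admissible ("more weakly decaying, albeit structured");
2. `phgClass_subset_structurelessClass`: if every exponent of `E` exceeds `3/2 + δ` and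
   `3/2 + δ ≤ 3 + ε₀`, then `PhgClass E ε₀ ⊆ StructurelessClass δ` — the common regime in which both
   theorems speak (for small `|a|`);
3. `scaleSum_coeff_eq_zero` (asymptotic independence of the scale `rLogScale (a,b) r = r^a (log r)^b`,
   `(a,b) ∈ ℝ × ℝ` ordered lexicographically, `tendsto_rLogScale_div`: a finite combination tending to
   `0` has zero coefficient on every pair `(a,b)` with `a > 0`, or `a = 0 < b`) and its consequence
   `slProfile_not_phgClass`: `slProfile r = r^{-7/4} (log r)^{1/2}` lies in `StructurelessClass δ` for
   every `δ < 1/4` (`slProfile_mem_structurelessClass`) but in NO `PhgClass E ε₀` with `E` finite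
   (real exponents, natural log-powers) and `ε₀ > 0` — a structureless profile is not a finite
   polyhomogeneous expansion plus an `O(r^{-3-ε₀})` remainder ("for structureless data, our result
   requires `O(r^{-3-ε₀})`-decay").

Hence neither model class contains the other; He–Klainerman's "more restrictive" holds for the
remainder component only. (Thm 13.1 allows complex exponents `𝓔₀ ⊂ ℂ × ℕ₀`; item 3 is stated for
real exponents — the form of Thm 1.1/(1.4) "`z > 1`" — where lexicographic leading-term analysis
suffices; the complex case would need an almost-periodicity argument and is not formalised.)
Census context: `run/shared/lean/pub/pub-kerr/ADEP.md` §D/§E, `HINTZ-PLAN.md` P6 (c1).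

## References
* P. Hintz, arXiv:2606.28253v2 (2026): Thm 1.1, (1.4)–(1.5), footnote 1 (pp. 2–3), Remark 1.3,
  Thm 13.1 (13.1a) (p. 318). Key `Hintz2026` (claim under review; only the DATA CLASS is used here).
* L. He, S. Klainerman, arXiv:2607.08958 (2026), §1.1 p. 6. Key `HeKlainerman2026`.
* S. Klainerman, J. Szeftel, PAMQ 19 (2023) = arXiv:2104.11857, §3 (admissible initial data layers).
-/

noncomputable section

open Filter Asymptotics
open scoped _root_.Topology

namespace Literature.Geometry.Lorentzian.Hintz2026

/-! ## The two radial model classes -/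

/-- The **partially polyhomogeneous radial model class** of Hintz's initial data (Thm 1.1 /
(1.4)–(1.5) / (13.1a), at the level of size in `r`): `f` differs from a FINITE expansion
`Σ_{(z,k) ∈ E} c_{(z,k)} r^{-z} (log r)^k` by a remainder `O(r^{-(3+ε₀)})` as `r → ∞`.
Here `E : Finset (ℝ × ℕ)` lists (exponent, log-power) pairs (real exponents: the form "`z > 1`" of
Thm 1.1; the constraint `z > 1 + ε₀` of the source is not imposed — every result below holds for
arbitrary finite `E`). [cite: Hintz2026, Thm 1.1 and (1.4)-(1.5), pp. 2-3 (data class only; claim under review)] -/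
def PhgClass (E : Finset (ℝ × ℕ)) (ε₀ : ℝ) (f : ℝ → ℝ) : Prop :=
  ∃ c : ℝ × ℕ → ℝ,
    (fun r => f r - ∑ p ∈ E, c p * r ^ (-p.1) * Real.log r ^ p.2) =O[atTop]
      fun r => r ^ (-(3 + ε₀))

/-- The **structureless radial model class** of Klainerman–Szeftel-type data: a pure size bound
`f = O(r^{-(3/2+δ)})` as `r → ∞` (the "structureless `O(r^{-3/2-ε₀})`-decay" of Hintz's footnote 1
and of He–Klainerman p. 6). [cite: HeKlainerman2026, Section 1.1 p. 6] -/
def StructurelessClass (δ : ℝ) (f : ℝ → ℝ) : Prop :=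
  f =O[atTop] fun r => r ^ (-(3 / 2 + δ))

/-! ## 1. The structured part of Hintz's class is not structureless-admissible -/

/-- `r ↦ r^{-5/4}` is (trivially) in the polyhomogeneous class with the single index `(5/4, 0)`,
for every remainder order `ε₀`. [folklore] -/
theorem rpow_mem_phgClass (ε₀ : ℝ) :
    PhgClass {((5 : ℝ) / 4, 0)} ε₀ (fun r => r ^ (-(5 / 4 : ℝ))) := by
  refine ⟨fun _ => 1, ?_⟩
  have h : (fun r : ℝ => r ^ (-(5 / 4 : ℝ)) -
      ∑ p ∈ ({((5 : ℝ) / 4, 0)} : Finset (ℝ × ℕ)), (1 : ℝ) * r ^ (-p.1) * Real.log r ^ p.2) =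
      fun _ => 0 := by
    funext r
    simp
  rw [h]
  exact isBigO_zero _ _

/-- `r ↦ r^{-5/4}` is in no structureless class `O(r^{-(3/2+δ)})`, `δ > 0` (indeed for `δ > -1/4`).
[folklore] -/
theorem rpow_not_structurelessClass {δ : ℝ} (hδ : -1 / 4 < δ) :
    ¬ StructurelessClass δ (fun r => r ^ (-(5 / 4 : ℝ))) := by
  intro h
  -- multiply by `r^{5/4}`: `1 = O(r^{-(1/4+δ)})`, and the right-hand side tends to `0`
  have h1 : (fun r : ℝ => r ^ (-(5 / 4 : ℝ)) * r ^ ((5 / 4 : ℝ))) =O[atTop]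
      fun r => r ^ (-(3 / 2 + δ)) * r ^ ((5 / 4 : ℝ)) :=
    h.mul (isBigO_refl _ _)
  have h2 : (fun _ : ℝ => (1 : ℝ)) =O[atTop] fun r : ℝ => r ^ (-(1 / 4 + δ)) := by
    refine (h1.congr' ?_ ?_)
    · filter_upwards [eventually_gt_atTop (0 : ℝ)] with r hr
      rw [← Real.rpow_add hr]; norm_num
    · filter_upwards [eventually_gt_atTop (0 : ℝ)] with r hr
      rw [← Real.rpow_add hr]; congr 1; ring
  have h3 : Tendsto (fun r : ℝ => r ^ (-(1 / 4 + δ))) atTop (𝓝 0) :=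
    tendsto_rpow_neg_atTop (by linarith)
  have h4 : Tendsto (fun _ : ℝ => (1 : ℝ)) atTop (𝓝 0) := h2.trans_tendsto h3
  have := tendsto_nhds_unique h4 tendsto_const_nhds
  norm_num at this

/-! ## 2. The common regime -/

/-- A single scale term `r^{-z} (log r)^k` with `z > 3/2 + δ` is `o(r^{-(3/2+δ)})`. [folklore] -/
theorem rpow_mul_log_pow_isLittleO {z δ : ℝ} (k : ℕ) (hz : 3 / 2 + δ < z) :
    (fun r : ℝ => r ^ (-z) * Real.log r ^ k) =o[atTop] fun r => r ^ (-(3 / 2 + δ)) := by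
  have hs : 0 < z - (3 / 2 + δ) := by linarith
  have hlog : (fun r : ℝ => Real.log r ^ k) =o[atTop] fun r => r ^ (z - (3 / 2 + δ)) := by
    have := isLittleO_log_rpow_rpow_atTop (k : ℝ) hs
    refine this.congr' ?_ EventuallyEq.rfl
    filter_upwards with r
    exact Real.rpow_natCast _ _
  have h := (isBigO_refl (fun r : ℝ => r ^ (-z)) atTop).mul_isLittleO hlog
  refine h.congr' EventuallyEq.rfl ?_
  filter_upwards [eventually_gt_atTop (0 : ℝ)] with r hr
  rw [← Real.rpow_add hr]; congr 1; ring

/-- **Common regime.** If every exponent in `E` exceeds `3/2 + δ` and the remainder order satisfies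
`3/2 + δ ≤ 3 + ε₀`, the polyhomogeneous class is contained in the structureless class
`O(r^{-(3/2+δ)})` — the data for which both Hintz's Thm 13.1 and (for `|a| ≪ m`) the
Klainerman–Szeftel theorem speak. [folklore] -/
theorem phgClass_subset_structurelessClass {E : Finset (ℝ × ℕ)} {ε₀ δ : ℝ} {f : ℝ → ℝ}
    (hE : ∀ p ∈ E, 3 / 2 + δ < p.1) (hδ : 3 / 2 + δ ≤ 3 + ε₀) (hf : PhgClass E ε₀ f) :
    StructurelessClass δ f := by
  obtain ⟨c, hc⟩ := hf
  -- the remainder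
  have hrem : (fun r : ℝ => r ^ (-(3 + ε₀))) =O[atTop] fun r => r ^ (-(3 / 2 + δ)) := by
    refine IsBigO.of_bound 1 ?_
    filter_upwards [eventually_ge_atTop (1 : ℝ)] with r hr
    rw [one_mul, Real.norm_of_nonneg (Real.rpow_nonneg (by linarith) _),
      Real.norm_of_nonneg (Real.rpow_nonneg (by linarith) _)]
    exact Real.rpow_le_rpow_of_exponent_le hr (by linarith)
  -- the expansion
  have hsum : (fun r : ℝ => ∑ p ∈ E, c p * r ^ (-p.1) * Real.log r ^ p.2) =O[atTop]
      fun r => r ^ (-(3 / 2 + δ)) := by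
    refine IsBigO.sum fun p hp => ?_
    have h := (rpow_mul_log_pow_isLittleO (δ := δ) p.2 (hE p hp)).isBigO.const_mul_left (c p)
    refine h.congr' ?_ EventuallyEq.rfl
    filter_upwards with r
    ring
  have h := (hc.trans hrem).add hsum
  refine h.congr' ?_ EventuallyEq.rfl
  filter_upwards with r
  simp only [sub_add_cancel]

/-! ## 3. Asymptotic independence of the scale `r^a (log r)^b` and a structureless profile
outside every finite polyhomogeneous class -/

/-- The two-parameter asymptotic scale `r ↦ r^a (log r)^b`, `(a, b) ∈ ℝ × ℝ` (real powers).
[folklore] -/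
def rLogScale (p : ℝ × ℝ) (r : ℝ) : ℝ := r ^ p.1 * Real.log r ^ p.2

/-- `rLogScale q r ≠ 0` for `r > 1`. [folklore] -/
theorem rLogScale_ne_zero (q : ℝ × ℝ) {r : ℝ} (hr : 1 < r) : rLogScale q r ≠ 0 :=
  mul_ne_zero (Real.rpow_pos_of_pos (by linarith) _).ne' (Real.rpow_pos_of_pos (Real.log_pos hr) _).ne'

/-- Ratio of two scale functions, for `r > 1`. [folklore] -/
theorem rLogScale_div_eq (p q : ℝ × ℝ) {r : ℝ} (hr : 1 < r) :
    rLogScale p r / rLogScale q r = r ^ (p.1 - q.1) * Real.log r ^ (p.2 - q.2) := by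
  have h1 : 0 < r := by linarith
  have h2 : 0 < Real.log r := Real.log_pos hr
  simp only [rLogScale]
  rw [Real.rpow_sub h1, Real.rpow_sub h2, mul_div_mul_comm]

/-- **The scale is lexicographically ordered**: if `(a, b) < (a', b')` lexicographically then
`r^a (log r)^b / (r^{a'} (log r)^{b'}) → 0` as `r → ∞`. [folklore] -/
theorem tendsto_rLogScale_div {p q : ℝ × ℝ} (h : toLex p < toLex q) :
    Tendsto (fun r => rLogScale p r / rLogScale q r) atTop (𝓝 0) := by
  rw [Prod.Lex.lt_iff] at h
  simp only [ofLex_toLex] at h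
  rcases h with h1 | ⟨h1, h2⟩
  · -- `p.1 < q.1`: a power of `log` loses against any positive power of `r`
    have hs : 0 < q.1 - p.1 := by linarith
    have hlo := (isLittleO_log_rpow_rpow_atTop (p.2 - q.2) hs).tendsto_div_nhds_zero
    refine hlo.congr' ?_
    filter_upwards [eventually_gt_atTop (1 : ℝ)] with r hr
    have h0 : 0 < r := by linarith
    rw [rLogScale_div_eq p q hr, div_eq_mul_inv, ← Real.rpow_neg h0.le, neg_sub, mul_comm]
  · -- `p.1 = q.1`, `p.2 < q.2`: a negative power of `log r`
    have hb : 0 < q.2 - p.2 := by linarith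
    have hlo := (tendsto_rpow_neg_atTop hb).comp Real.tendsto_log_atTop
    refine hlo.congr' ?_
    filter_upwards [eventually_gt_atTop (1 : ℝ)] with r hr
    rw [Function.comp_apply, rLogScale_div_eq p q hr, h1, sub_self, Real.rpow_zero, one_mul, neg_sub]

/-- **Asymptotic independence of the scale.** If a finite real combination
`Σ_{x ∈ S} d_x r^{x.1} (log r)^{x.2}` tends to `0` as `r → ∞`, then `d_x = 0` for every
`x ∈ S` that is lexicographically above `(0, 0)` (i.e. `x.1 > 0`, or `x.1 = 0 < x.2`) — such scale
functions do not tend to `0`, and no cancellation among distinct scale functions can help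
(leading-term induction on the lexicographic maximum of `S`). [folklore] -/
theorem scaleSum_coeff_eq_zero (d : ℝ × ℝ → ℝ) (S : Finset (ℝ × ℝ))
    (hS : Tendsto (fun r => ∑ x ∈ S, d x * rLogScale x r) atTop (𝓝 0))
    {p : ℝ × ℝ} (hp : p ∈ S) (hpos : toLex ((0 : ℝ), (0 : ℝ)) < toLex p) : d p = 0 := by
  induction S using Finset.strongInduction generalizing p with
  | H S ih =>
    obtain ⟨q, hqS, hqmax⟩ := S.exists_max_image (fun x => toLex x) ⟨p, hp⟩
    have hqpos : toLex ((0 : ℝ), (0 : ℝ)) < toLex q := lt_of_lt_of_le hpos (hqmax p hp)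
    -- Step 1: the leading coefficient vanishes.
    have hdq : d q = 0 := by
      -- `T r := Σ_x d_x rLogScale x r / rLogScale q r` tends both to `d q` and to `0`.
      have hT1 : Tendsto (fun r => ∑ x ∈ S, d x * (rLogScale x r / rLogScale q r)) atTop
          (𝓝 (∑ x ∈ S, if x = q then d q else 0)) := by
        refine tendsto_finsetSum S fun x hx => ?_
        by_cases hxq : x = q
        · rw [if_pos hxq, hxq]
          refine (tendsto_const_nhds (x := d q)).congr' ?_
          filter_upwards [eventually_gt_atTop (1 : ℝ)] with r hr
          rw [div_self (rLogScale_ne_zero q hr), mul_one]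
        · rw [if_neg hxq]
          have hlt : toLex x < toLex q :=
            lt_of_le_of_ne (hqmax x hx) (fun h => hxq (toLex.injective h))
          simpa using (tendsto_rLogScale_div hlt).const_mul (d x)
      have hsum : (∑ x ∈ S, if x = q then d q else 0) = d q := by
        rw [Finset.sum_ite_eq' S q (fun _ => d q), if_pos hqS]
      rw [hsum] at hT1
      have hT2 : Tendsto (fun r => ∑ x ∈ S, d x * (rLogScale x r / rLogScale q r)) atTop (𝓝 0) := by
        have h0 : Tendsto (fun r => (rLogScale q r)⁻¹) atTop (𝓝 0) := by
          refine (tendsto_rLogScale_div hqpos).congr' ?_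
          filter_upwards with r
          simp [rLogScale]
        have h := hS.mul h0
        rw [mul_zero] at h
        refine h.congr' ?_
        filter_upwards with r
        rw [Finset.sum_mul]
        refine Finset.sum_congr rfl fun x _ => ?_
        rw [div_eq_mul_inv, mul_assoc]
      exact tendsto_nhds_unique hT1 hT2
    -- Step 2: remove the leading term and induct.
    by_cases hpq : p = q
    · rw [hpq]; exact hdq
    · have hp' : p ∈ S.erase q := Finset.mem_erase.mpr ⟨hpq, hp⟩
      refine ih (S.erase q) (Finset.erase_ssubset hqS) ?_ hp' hpos
      have heq : (fun r => ∑ x ∈ S.erase q, d x * rLogScale x r) =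
          fun r => ∑ x ∈ S, d x * rLogScale x r := by
        funext r
        rw [← Finset.sum_erase_add S _ hqS, hdq, zero_mul, add_zero]
      rw [heq]
      exact hS

/-- The structureless model profile `r ↦ r^{-7/4} (log r)^{1/2}` (conormal, `O(r^{-3/2-δ})` for every
`δ < 1/4`, but not a finite polyhomogeneous expansion). [folklore] -/
def slProfile (r : ℝ) : ℝ := r ^ (-(7 / 4 : ℝ)) * Real.log r ^ (1 / 2 : ℝ)

/-- `slProfile ∈ StructurelessClass δ` for every `δ < 1/4`. [folklore] -/
theorem slProfile_mem_structurelessClass {δ : ℝ} (hδ : δ < 1 / 4) :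
    StructurelessClass δ slProfile := by
  have hs : 0 < 1 / 4 - δ := by linarith
  have hlog : (fun r : ℝ => Real.log r ^ (1 / 2 : ℝ)) =o[atTop] fun r => r ^ (1 / 4 - δ) :=
    isLittleO_log_rpow_rpow_atTop _ hs
  have h := (isBigO_refl (fun r : ℝ => r ^ (-(7 / 4 : ℝ))) atTop).mul_isLittleO hlog
  refine (h.congr' EventuallyEq.rfl ?_).isBigO
  filter_upwards [eventually_gt_atTop (0 : ℝ)] with r hr
  rw [← Real.rpow_add hr]; congr 1; ring

/-- The exponent map `(z, k) ↦ (7/4 - z, k)`: after multiplication by `r^{7/4}` the term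
`r^{-z} (log r)^k` becomes the scale function of this pair. [folklore] -/
def shiftExp (p : ℝ × ℕ) : ℝ × ℝ := (7 / 4 - p.1, (p.2 : ℝ))

/-- `(0, 1/2)` is not of the form `shiftExp p` (its log-power is not a natural number). [folklore] -/
theorem shiftExp_ne (p : ℝ × ℕ) : shiftExp p ≠ ((0 : ℝ), (1 / 2 : ℝ)) := by
  intro h
  have h2 : ((p.2 : ℕ) : ℝ) = 1 / 2 := (Prod.mk.inj h).2
  have h3 : ((2 * p.2 : ℕ) : ℝ) = 1 := by push_cast; linarith
  have h4 : 2 * p.2 = 1 := by exact_mod_cast h3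
  omega

/-- **A structureless profile outside every finite (real) polyhomogeneous class.**
`slProfile ∉ PhgClass E ε₀` for every finite `E ⊂ ℝ × ℕ` and every `ε₀ > 0`: multiplying a putative
expansion by `r^{7/4}` gives a finite scale combination `(log r)^{1/2} − Σ_x d_x r^{x.1}(log r)^{x.2}`
(with natural `x.2`, hence all `x ≠ (0, 1/2)`) tending to `0`, contradicting
`scaleSum_coeff_eq_zero` at the pair `(0, 1/2)`. [folklore] -/
theorem slProfile_not_phgClass (E : Finset (ℝ × ℕ)) {ε₀ : ℝ} (hε : 0 < ε₀) :
    ¬ PhgClass E ε₀ slProfile := by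
  classical
  rintro ⟨c, hc⟩
  -- the renormalised remainder `g r := r^{7/4} (slProfile r − expansion)` tends to `0`
  set g : ℝ → ℝ := fun r => r ^ (7 / 4 : ℝ) *
    (slProfile r - ∑ p ∈ E, c p * r ^ (-p.1) * Real.log r ^ p.2) with hg
  have hg0 : Tendsto g atTop (𝓝 0) := by
    have h1 : g =O[atTop] fun r => r ^ (7 / 4 : ℝ) * r ^ (-(3 + ε₀)) :=
      (isBigO_refl (fun r : ℝ => r ^ (7 / 4 : ℝ)) atTop).mul hc
    have h2 : (fun r : ℝ => r ^ (7 / 4 : ℝ) * r ^ (-(3 + ε₀))) =ᶠ[atTop]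
        fun r => r ^ (-(5 / 4 + ε₀)) := by
      filter_upwards [eventually_gt_atTop (0 : ℝ)] with r hr
      rw [← Real.rpow_add hr]; congr 1; ring
    exact (h1.congr' EventuallyEq.rfl h2).trans_tendsto (tendsto_rpow_neg_atTop (by linarith))
  -- the index set and coefficients of the scale combination
  set a₀ : ℝ × ℝ := ((0 : ℝ), (1 / 2 : ℝ)) with ha₀
  set T : Finset (ℝ × ℝ) := E.image shiftExp with hT
  have ha₀T : a₀ ∉ T := by
    intro h
    obtain ⟨p, -, hp⟩ := Finset.mem_image.mp h
    exact shiftExp_ne p hp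
  set d : ℝ × ℝ → ℝ := fun x => if x = a₀ then 1 else -∑ p ∈ E with shiftExp p = x, c p with hd
  have hda₀ : d a₀ = 1 := by simp [hd]
  -- `g` IS that scale combination, eventually
  have hgS : (fun r => ∑ x ∈ insert a₀ T, d x * rLogScale x r) =ᶠ[atTop] g := by
    filter_upwards [eventually_gt_atTop (1 : ℝ)] with r hr
    have h0 : 0 < r := by linarith
    rw [Finset.sum_insert ha₀T, hda₀, one_mul]
    -- the image part, fibrewise
    have himg : ∑ x ∈ T, d x * rLogScale x r =
        -∑ p ∈ E, c p * (r ^ (7 / 4 : ℝ) * (r ^ (-p.1) * Real.log r ^ p.2)) := by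
      have hdx : ∀ x ∈ T, d x = -∑ p ∈ E with shiftExp p = x, c p := by
        intro x hx
        have : x ≠ a₀ := fun h => ha₀T (h ▸ hx)
        simp [hd, this]
      rw [Finset.sum_congr rfl fun x hx => by rw [hdx x hx]]
      simp only [neg_mul, Finset.sum_neg_distrib, Finset.sum_mul, neg_inj]
      -- inside each fibre `shiftExp i = x`, rename the scale function
      have hfib : ∀ x ∈ T, ∑ i ∈ E with shiftExp i = x, c i * rLogScale x r =
          ∑ i ∈ E with shiftExp i = x, c i * rLogScale (shiftExp i) r := fun x _ =>
        Finset.sum_congr rfl fun i hi => by rw [(Finset.mem_filter.mp hi).2]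
      rw [Finset.sum_congr rfl hfib]
      rw [Finset.sum_fiberwise_of_maps_to (fun p hp => Finset.mem_image_of_mem shiftExp hp)]
      refine Finset.sum_congr rfl fun p _ => ?_
      simp only [rLogScale, shiftExp]
      rw [Real.rpow_sub h0, Real.rpow_natCast, Real.rpow_neg h0.le]
      field_simp
    rw [himg, hg]
    simp only
    rw [mul_sub, Finset.mul_sum, sub_eq_add_neg]
    congr 1
    · simp only [rLogScale, slProfile, ha₀]
      rw [Real.rpow_zero, one_mul, ← mul_assoc, ← Real.rpow_add h0]
      norm_num
    · congr 1
      exact Finset.sum_congr rfl fun p _ => by ring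
  -- contradiction: the coefficient of `(0, 1/2)` would have to vanish
  have hpos : toLex ((0 : ℝ), (0 : ℝ)) < toLex a₀ := by
    rw [ha₀, Prod.Lex.lt_iff]
    norm_num [ofLex_toLex]
  have h0 := scaleSum_coeff_eq_zero d (insert a₀ T) (hg0.congr' hgS.symm)
    (Finset.mem_insert_self a₀ T) hpos
  rw [hda₀] at h0
  exact one_ne_zero h0

end Literature.Geometry.Lorentzian.Hintz2026
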